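import Summits.QuantumFields.YangMills.Theorems.BalabanLadderIRKernelLargeField
import Summits.QuantumFields.YangMills.Theorems.BalabanLadderIRTorusUpgrade
import HarnessLib

/-!
# `IR` — the DILUTE typical class: sup-`ζ` single-cell rarity of «every sub-box of side `ℓ` has small action»,
# hence clauses (ii_T) and (iii_T) of `TypShellCond` for it (kernel AND torus level)

Spine route `BalabanLadder` (route-QuantumFields-BalabanLadder), crux `IR` (stmt-QuantumFields-19354), registered line
«af-pincer-T» (skeleton 0308f95ca6f6a115).  Owner READING R37 (b) / cruxidea-7 C-b: the optional factor
`Typ_dilute(L₀, t)` of the recommended typical class — «density-good in every sub-cube of side `L₀`».  This file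
types it over the tree (`diluteTyp ρ w ℓ T c`: every sub-box of side `ℓ` of the cell `c` has `actionIn < T`), proves
the two bookkeeping conjuncts of `TypShellCond` for it (measurable, cell-local), proves its SINGLE-CELL sup-`ζ`
RARITY from the kernel-level large-field bound `IRKernelLargeField.kernel_measureReal_le_actionIn_le_of_subset`
(DLR localisation to the sub-box kernel + Gaussian small-ball lower bound; union over the `≤ (2b)⁴` sub-boxes), and
concludes clauses **(ii_T)** and **(iii_T)** of `TypShellCond` for `Typ := diluteTyp ρ w ℓ T` by the landed
upgrades `IRRarityUpgrade.collarJointRarity_of_supCellRarity` / `torusJointRarity_of_supCellRarity`.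
Count-neutral helper (`--supports stmt-QuantumFields-19354 --as helper`); no stub claimed, no skeleton touched.

## The numbers

For a sub-box of side `ℓ ≥ 1`: `#E = 4ℓ⁴` links, `n_in ≤ 6ℓ⁴` plaquettes, `n_bd ≤ 6((ℓ+1)⁴ − (ℓ−1)⁴) ≤ 96ℓ³`
boundary plaquettes (`card_boxEdges`, `card_plaqsIn_boxEdges_le`, `card_bd_boxEdges_le`).  Hence, with a ball mass
`Haar{‖ρ g − 1‖ ≤ δ} ≥ m > 0`, the single-cell rarity budget is
`δ_cell = (2b)⁴ · exp(β(48 δ² ℓ⁴ + 192 N ℓ³) − βT) / m^{4ℓ⁴}` (`supCellRarity_diluteTyp`), uniformly in the exterior,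
and (ii_T)/(iii_T) hold with this `δ_cell` (`collarJointRarity_diluteTyp`, `torusJointRarity_diluteTyp`).  For a
faithful `r : LatticeRep G` take `δ = β^{−1/2}`, `m = C₁ β^{−D/2}` (`exists_haar_gball_ge`): with `T = t · 6ℓ⁴` the
exponent is `−6ℓ⁴[βt − 8 − 32Nβ/ℓ − (2/3)((D/2) log β − log C₁)] + 4 log(2b)`, i.e. the class is rare as soon as the
density threshold `t` exceeds `32N/ℓ + (D log β + O(1))/(3β)` — sub-boxes of side `ℓ ≍ β/log β` reach
`t ≍ log β / β`, the dilute threshold of C-b.  (This file keeps `T`, `δ`, `m` symbolic; the arithmetic is the caller's.)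

Everything here is proved (no `sorry`, no new axioms).  HONEST FRAMING: the dilute factor is the EASY, bulk-dimensional
component of the typical class (energy `≍ ℓ⁴ t` against entropy `≍ ℓ⁴ log β` at the scale of the resampled
sub-box); it does not exclude walls/sheets (surface statistics), for which the owner's located datum says sup-`ζ`
rarity is false and a collar-typical Peierls lemma is needed; (i_T) and the bridge carry the IR weight; conditional
chain untouched; not a gap, not Clay.
-/

set_option autoImplicit false

noncomputable section

open MeasureTheory
open scoped ENNReal Matrix.Norms.Frobenius
open Literature.Probability.LatticeModels
open Literature.MathematicalPhysics.QuantumLattice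
open Literature.MathematicalPhysics.QuantumFieldTheory (GaugeConfig wilsonMeasure haarProbability)
open Summit.QuantumFields.YangMills.Cruxes.IR.Tempered (cellEdges regionEdges)
open Summit.QuantumFields.YangMills.Theorems.OddTorusChessboard (cellSites mem_cellSites card_cellSites_le grid_monotone)
open Summit.QuantumFields.YangMills.Theorems.IRRarityUpgrade (regionEdges_singleton collarJointRarity_of_supCellRarity
  torusJointRarity_of_supCellRarity)

namespace Summit.QuantumFields.YangMills.Theorems.IRKernelLargeField

/-! ## §1 Sub-boxes and their counts -/

section Boxes

/-- The sites of the box of side `ℓ` with lower corner `x₀`: `∏ᵢ [x₀ i, x₀ i + ℓ)`. -/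
def boxSites (x₀ : Site 4) (ℓ : ℕ) : Finset (Site 4) :=
  Fintype.piFinset fun i : Fin 4 => Finset.Ico (x₀ i) (x₀ i + ℓ)

/-- The links based in the box: `boxSites x₀ ℓ ×ˢ univ`. -/
def boxEdges (x₀ : Site 4) (ℓ : ℕ) : Finset (ZdEdge 4) :=
  boxSites x₀ ℓ ×ˢ (Finset.univ : Finset (Fin 4))

/-- Membership in `boxSites`. -/
theorem mem_boxSites {x₀ : Site 4} {ℓ : ℕ} {x : Site 4} :
    x ∈ boxSites x₀ ℓ ↔ ∀ i, x₀ i ≤ x i ∧ x i < x₀ i + ℓ := by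
  simp [boxSites, Fintype.mem_piFinset]

/-- Membership in `boxEdges`. -/
theorem mem_boxEdges {x₀ : Site 4} {ℓ : ℕ} {e : ZdEdge 4} : e ∈ boxEdges x₀ ℓ ↔ e.1 ∈ boxSites x₀ ℓ := by
  simp [boxEdges]

/-- `#boxSites = ℓ⁴`. -/
theorem card_boxSites (x₀ : Site 4) (ℓ : ℕ) : (boxSites x₀ ℓ).card = ℓ ^ 4 := by
  unfold boxSites
  rw [Fintype.card_piFinset]
  simp only [Int.card_Ico, add_sub_cancel_left, Int.toNat_natCast, Finset.prod_const, Finset.card_univ,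
    Fintype.card_fin]

/-- `#boxEdges = 4ℓ⁴`. -/
theorem card_boxEdges (x₀ : Site 4) (ℓ : ℕ) : (boxEdges x₀ ℓ).card = 4 * ℓ ^ 4 := by
  rw [boxEdges, Finset.card_product, card_boxSites, Finset.card_univ, Fintype.card_fin, mul_comm]

/-- A plaquette of the box is based in the box. -/
theorem fst_mem_boxSites_of_mem_plaqsIn {x₀ : Site 4} {ℓ : ℕ} {p : ZdPlaquette 4}
    (hp : p ∈ plaqsIn (boxEdges x₀ ℓ)) : p.1 ∈ boxSites x₀ ℓ := by
  have h := plaquetteEdges_subset_of_mem_plaqsIn hp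
  have : (p.1, p.2.1.1) ∈ boxEdges x₀ ℓ := h (by simp [plaquetteEdges])
  exact mem_boxEdges.1 this

/-- `n_in ≤ 6ℓ⁴`. -/
theorem card_plaqsIn_boxEdges_le (x₀ : Site 4) (ℓ : ℕ) : (plaqsIn (boxEdges x₀ ℓ)).card ≤ 6 * ℓ ^ 4 := by
  classical
  calc (plaqsIn (boxEdges x₀ ℓ)).card
      ≤ (boxSites x₀ ℓ ×ˢ (Finset.univ : Finset {p : Fin 4 × Fin 4 // p.1 < p.2})).card :=
        Finset.card_le_card fun p hp => Finset.mem_product.2 ⟨fst_mem_boxSites_of_mem_plaqsIn hp, Finset.mem_univ _⟩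
    _ = 6 * ℓ ^ 4 := by rw [Finset.card_product, card_boxSites, Finset.card_univ, (show Fintype.card {p : Fin 4 × Fin 4 // p.1 < p.2} = 6 by decide), mul_comm]

/-- A plaquette touching the box is based in the box enlarged by one below: `∏ᵢ [x₀ i − 1, x₀ i + ℓ)`. -/
theorem fst_mem_of_mem_plaquettesTouching_boxEdges {x₀ : Site 4} {ℓ : ℕ} {p : ZdPlaquette 4}
    (hp : p ∈ plaquettesTouching (boxEdges x₀ ℓ)) :
    p.1 ∈ Fintype.piFinset fun i : Fin 4 => Finset.Ico (x₀ i - 1) (x₀ i + ℓ) := by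
  obtain ⟨e, he⟩ := mem_plaquettesTouching_iff.1 hp
  rw [Finset.mem_inter] at he
  obtain ⟨he1, he2⟩ := he
  have hx := mem_boxSites.1 (mem_boxEdges.1 he2)
  rw [Fintype.mem_piFinset]
  intro k
  rw [Finset.mem_Ico]
  have hk := hx k
  simp only [plaquetteEdges, Finset.mem_insert, Finset.mem_singleton] at he1
  rcases he1 with rfl | rfl | rfl | rfl
  · simp only at hk; omega
  · simp only [Pi.add_apply, Pi.single_apply] at hk
    split_ifs at hk <;> omega
  · simp only [Pi.add_apply, Pi.single_apply] at hk
    split_ifs at hk <;> omega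
  · simp only at hk; omega

/-- `#plaquettesTouching ≤ 6(ℓ+1)⁴`. -/
theorem card_plaquettesTouching_boxEdges_le (x₀ : Site 4) (ℓ : ℕ) :
    (plaquettesTouching (boxEdges x₀ ℓ)).card ≤ 6 * (ℓ + 1) ^ 4 := by
  classical
  calc (plaquettesTouching (boxEdges x₀ ℓ)).card
      ≤ ((Fintype.piFinset fun i : Fin 4 => Finset.Ico (x₀ i - 1) (x₀ i + ℓ)) ×ˢ
          (Finset.univ : Finset {p : Fin 4 × Fin 4 // p.1 < p.2})).card :=
        Finset.card_le_card fun p hp =>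
          Finset.mem_product.2 ⟨fst_mem_of_mem_plaquettesTouching_boxEdges hp, Finset.mem_univ _⟩
    _ = 6 * (ℓ + 1) ^ 4 := by
        rw [Finset.card_product, Fintype.card_piFinset, Finset.card_univ, (show Fintype.card {p : Fin 4 × Fin 4 // p.1 < p.2} = 6 by decide)]
        simp only [Int.card_Ico]
        have : ∀ i : Fin 4, (x₀ i + ℓ - (x₀ i - 1)).toNat = ℓ + 1 := fun i => by omega
        simp only [this, Finset.prod_const, Finset.card_univ, Fintype.card_fin, mul_comm]

/-- Plaquettes based in the box shrunk by one above, `∏ᵢ [x₀ i, x₀ i + ℓ − 1)`, are plaquettes of the box. -/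
theorem product_inner_subset_plaqsIn (x₀ : Site 4) (ℓ : ℕ) :
    (Fintype.piFinset fun i : Fin 4 => Finset.Ico (x₀ i) (x₀ i + ℓ - 1)) ×ˢ
        (Finset.univ : Finset {p : Fin 4 × Fin 4 // p.1 < p.2}) ⊆ plaqsIn (boxEdges x₀ ℓ) := by
  classical
  intro p hp
  rw [Finset.mem_product, Fintype.mem_piFinset] at hp
  have hy : ∀ k, x₀ k ≤ p.1 k ∧ p.1 k < x₀ k + ℓ - 1 := fun k => Finset.mem_Ico.1 (hp.1 k)
  have hin : ∀ (i : Fin 4), (p.1 + Pi.single i 1) ∈ boxSites x₀ ℓ := fun i => by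
    rw [mem_boxSites]
    intro k
    simp only [Pi.add_apply, Pi.single_apply]
    have := hy k
    split_ifs <;> omega
  have h0 : p.1 ∈ boxSites x₀ ℓ := by
    rw [mem_boxSites]; intro k; have := hy k; omega
  have hE : plaquetteEdges p ⊆ boxEdges x₀ ℓ := by
    intro e he
    simp only [plaquetteEdges, Finset.mem_insert, Finset.mem_singleton] at he
    rcases he with rfl | rfl | rfl | rfl
    · exact mem_boxEdges.2 h0
    · exact mem_boxEdges.2 (hin _)
    · exact mem_boxEdges.2 (hin _)
    · exact mem_boxEdges.2 h0
  refine Finset.mem_filter.2 ⟨mem_plaquettesTouching_iff.2 ⟨(p.1, p.2.1.1), ?_⟩, hE⟩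
  exact Finset.mem_inter.2 ⟨by simp [plaquetteEdges], mem_boxEdges.2 h0⟩

/-- `n_in ≥ 6(ℓ−1)⁴` for `ℓ ≥ 1`. -/
theorem le_card_plaqsIn_boxEdges (x₀ : Site 4) {ℓ : ℕ} (hℓ : 1 ≤ ℓ) :
    6 * (ℓ - 1) ^ 4 ≤ (plaqsIn (boxEdges x₀ ℓ)).card := by
  classical
  refine le_trans (le_of_eq ?_) (Finset.card_le_card (product_inner_subset_plaqsIn x₀ ℓ))
  rw [Finset.card_product, Fintype.card_piFinset, Finset.card_univ, (show Fintype.card {p : Fin 4 × Fin 4 // p.1 < p.2} = 6 by decide)]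
  simp only [Int.card_Ico]
  have : ∀ i : Fin 4, (x₀ i + ℓ - 1 - x₀ i).toNat = ℓ - 1 := fun i => by omega
  simp only [this, Finset.prod_const, Finset.card_univ, Fintype.card_fin, mul_comm]

/-- `n_bd ≤ 96ℓ³` for `ℓ ≥ 1`: the boundary plaquettes of a box of side `ℓ`. -/
theorem card_bd_boxEdges_le (x₀ : Site 4) {ℓ : ℕ} (hℓ : 1 ≤ ℓ) :
    ((plaquettesTouching (boxEdges x₀ ℓ)).card : ℝ) - (plaqsIn (boxEdges x₀ ℓ)).card ≤ 96 * (ℓ : ℝ) ^ 3 := by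
  have h1 := card_plaquettesTouching_boxEdges_le x₀ ℓ
  have h2 := le_card_plaqsIn_boxEdges x₀ hℓ
  have h1' : ((plaquettesTouching (boxEdges x₀ ℓ)).card : ℝ) ≤ 6 * ((ℓ : ℝ) + 1) ^ 4 := by exact_mod_cast h1
  have h2' : 6 * ((ℓ : ℝ) - 1) ^ 4 ≤ (plaqsIn (boxEdges x₀ ℓ)).card := by
    have : ((ℓ - 1 : ℕ) : ℝ) = (ℓ : ℝ) - 1 := by rw [Nat.cast_sub hℓ, Nat.cast_one]
    rw [← this]; exact_mod_cast h2
  have hℓ' : (1 : ℝ) ≤ ℓ := by exact_mod_cast hℓ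
  nlinarith [hℓ', pow_le_pow_left₀ zero_le_one hℓ' 2, pow_le_pow_left₀ zero_le_one hℓ' 3]

end Boxes

/-! ## §2 The dilute typical class -/

section Dilute

variable {G : Type} [Group G] [TopologicalSpace G] [IsTopologicalGroup G] [CompactSpace G]
  [MeasurableSpace G] [BorelSpace G] {N : ℕ} (ρ : G →* Matrix (Fin N) (Fin N) ℂ)

/-- **The dilute typical class** `Typ_dilute(ℓ, T)` of the cell `c` of the grid `w`: every sub-box of side `ℓ` of the
cell has Wilson action (no boundary terms) `< T`. -/
def diluteTyp (w : Fin 4 → ℤ → ℤ) (ℓ : ℕ) (T : ℝ) (c : Fin 4 → ℤ) : Set (LGConfig 4 G) :=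
  {σ | ∀ x₀ : Site 4, boxSites x₀ ℓ ⊆ cellSites w c → actionIn ρ (boxEdges x₀ ℓ) σ < T}

omit [TopologicalSpace G] [IsTopologicalGroup G] [CompactSpace G] [MeasurableSpace G] [BorelSpace G] in
/-- A sub-box of the cell has its links among the links of the cell. -/
theorem boxEdges_subset_cellEdges {w : Fin 4 → ℤ → ℤ} {c : Fin 4 → ℤ} {x₀ : Site 4} {ℓ : ℕ}
    (h : boxSites x₀ ℓ ⊆ cellSites w c) : boxEdges x₀ ℓ ⊆ cellEdges w c := by
  intro e he
  have hx := h (mem_boxEdges.1 he)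
  rw [mem_cellSites] at hx
  simp only [Summit.QuantumFields.YangMills.Cruxes.IR.Tempered.cellEdges, Finset.mem_product, Fintype.mem_piFinset,
    Finset.mem_Ico, Finset.mem_univ, and_true]
  exact hx

omit [TopologicalSpace G] [IsTopologicalGroup G] [CompactSpace G] [MeasurableSpace G] [BorelSpace G] in
/-- `diluteTyp` is cell-local (conjunct 2 of `TypShellCond`). -/
theorem dependsOn_diluteTyp (w : Fin 4 → ℤ → ℤ) (ℓ : ℕ) (T : ℝ) (c : Fin 4 → ℤ) :
    DependsOn (fun σ : LGConfig 4 G => σ ∈ diluteTyp ρ w ℓ T c) ↑(cellEdges w c) := by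
  intro σ τ hστ
  simp only [diluteTyp, Set.mem_setOf_eq]
  refine propext (forall_congr' fun x₀ => imp_congr_right fun hx => ?_)
  rw [dependsOn_actionIn ρ (boxEdges x₀ ℓ) fun e he => hστ e (boxEdges_subset_cellEdges hx he)]

variable [SecondCountableTopology G]

omit [CompactSpace G] in
/-- `diluteTyp` is measurable (conjunct 1 of `TypShellCond`). -/
theorem measurableSet_diluteTyp (hρ : Continuous ρ) (w : Fin 4 → ℤ → ℤ) (ℓ : ℕ) (T : ℝ) (c : Fin 4 → ℤ) :
    MeasurableSet (diluteTyp ρ w ℓ T c) := by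
  have : diluteTyp ρ w ℓ T c =
      ⋂ x₀ : Site 4, {σ : LGConfig 4 G | boxSites x₀ ℓ ⊆ cellSites w c → actionIn ρ (boxEdges x₀ ℓ) σ < T} := by
    ext σ; simp [diluteTyp]
  rw [this]
  refine MeasurableSet.iInter fun x₀ => ?_
  by_cases hx : boxSites x₀ ℓ ⊆ cellSites w c
  · simp only [hx, forall_true_left]
    exact measurableSet_lt (measurable_actionIn ρ hρ _) measurable_const
  · simp only [hx, IsEmpty.forall_iff, Set.setOf_true, MeasurableSet.univ]

omit [SecondCountableTopology G] in
/-- The lower corners of the sub-boxes of side `ℓ ≥ 1` of the cell lie in the cell. -/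
theorem mem_cellSites_of_boxSites_subset {w : Fin 4 → ℤ → ℤ} {c : Fin 4 → ℤ} {x₀ : Site 4} {ℓ : ℕ} (hℓ : 1 ≤ ℓ)
    (h : boxSites x₀ ℓ ⊆ cellSites w c) : x₀ ∈ cellSites w c :=
  h (mem_boxSites.2 fun i => ⟨le_rfl, by omega⟩)

omit [TopologicalSpace G] [IsTopologicalGroup G] [CompactSpace G] [MeasurableSpace G] [BorelSpace G]
  [SecondCountableTopology G] in
/-- The complement of `diluteTyp` is the union, over the finitely many sub-boxes of the cell, of their large-action
events (`ℓ ≥ 1`). -/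
theorem compl_diluteTyp_subset {w : Fin 4 → ℤ → ℤ} {c : Fin 4 → ℤ} {ℓ : ℕ} (hℓ : 1 ≤ ℓ) (T : ℝ) :
    (diluteTyp ρ w ℓ T c)ᶜ ⊆ ⋃ x₀ ∈ (cellSites w c).filter (fun x₀ => boxSites x₀ ℓ ⊆ cellSites w c),
      {σ : LGConfig 4 G | T ≤ actionIn ρ (boxEdges x₀ ℓ) σ} := by
  intro σ hσ
  simp only [diluteTyp, Set.mem_compl_iff, Set.mem_setOf_eq, not_forall, not_lt, exists_prop] at hσ
  obtain ⟨x₀, hx, hT⟩ := hσ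
  simp only [Set.mem_iUnion, Set.mem_setOf_eq, Finset.mem_filter, exists_prop]
  exact ⟨x₀, ⟨mem_cellSites_of_boxSites_subset hℓ hx, hx⟩, hT⟩

variable [T2Space G]

/-- **Single-cell sup-`ζ` rarity of the dilute class** (`SupCellRarity` shape).  For a continuous unitary `ρ`,
`β ≥ 0`, a mesh-`b` frame `w`, `ℓ ≥ 1`, a radius `δ` with ball mass `Haar{‖ρ g − 1‖ ≤ δ} ≥ m > 0` and any
threshold `T`: resampling ONE cell under ANY exterior `ζ` produces a non-dilute cell with probability at most
`(2b)⁴ · exp(β(48δ²ℓ⁴ + 192Nℓ³) − βT) / m^{4ℓ⁴}`. -/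
theorem supCellRarity_diluteTyp (hρ : Continuous ρ) (hU : ∀ g, ρ g ∈ Matrix.unitaryGroup (Fin N) ℂ) {β : ℝ}
    (hβ : 0 ≤ β) {b : ℕ} {w : Fin 4 → ℤ → ℤ}
    (hw : ∀ i j, w i j + ((b : ℕ) : ℤ) ≤ w i (j + 1) ∧ w i (j + 1) ≤ w i j + 2 * ((b : ℕ) : ℤ))
    {ℓ : ℕ} (hℓ : 1 ≤ ℓ) {δ m : ℝ} (hm : 0 < m)
    (hball : ENNReal.ofReal m ≤ haarProbability G {g : G | ‖ρ g - 1‖ ≤ δ}) (T : ℝ) (c : Fin 4 → ℤ)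
    (ζ : LGConfig 4 G) :
    (ymSpecification ρ β (regionEdges w {c}) ζ) (diluteTyp ρ w ℓ T c)ᶜ ≤
      ENNReal.ofReal ((2 * b : ℝ) ^ 4 * (Real.exp (β * (48 * δ ^ 2 * (ℓ : ℝ) ^ 4 + 192 * N * (ℓ : ℝ) ^ 3) - β * T) /
        m ^ (4 * ℓ ^ 4))) := by
  classical
  rw [regionEdges_singleton]
  set X := (cellSites w c).filter (fun x₀ => boxSites x₀ ℓ ⊆ cellSites w c) with hX
  set B : ℝ := Real.exp (β * (48 * δ ^ 2 * (ℓ : ℝ) ^ 4 + 192 * N * (ℓ : ℝ) ^ 3) - β * T) / m ^ (4 * ℓ ^ 4) with hBdef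
  have hB0 : 0 ≤ B := by positivity
  -- each sub-box event
  have hbox : ∀ x₀ ∈ X, (ymSpecification ρ β (cellEdges w c) ζ) {σ : LGConfig 4 G | T ≤ actionIn ρ (boxEdges x₀ ℓ) σ} ≤
      ENNReal.ofReal B := by
    intro x₀ hx₀
    have hsub : boxEdges x₀ ℓ ⊆ cellEdges w c := boxEdges_subset_cellEdges (Finset.mem_filter.1 hx₀).2
    refine (kernel_apply_le_actionIn_le_of_subset ρ hρ hU hβ hsub ζ hm hball T).trans (ENNReal.ofReal_le_ofReal ?_)
    rw [card_boxEdges]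
    refine div_le_div_of_nonneg_right ?_ (pow_pos hm _).le
    rw [Real.exp_le_exp]
    have h1 : ((plaqsIn (boxEdges x₀ ℓ)).card : ℝ) ≤ 6 * (ℓ : ℝ) ^ 4 := by exact_mod_cast card_plaqsIn_boxEdges_le x₀ ℓ
    have h2 := card_bd_boxEdges_le x₀ hℓ
    have hN : (0 : ℝ) ≤ N := Nat.cast_nonneg N
    have hδ2 : 0 ≤ δ ^ 2 := sq_nonneg δ
    have h1' : 8 * δ ^ 2 * ((plaqsIn (boxEdges x₀ ℓ)).card : ℝ) ≤ 48 * δ ^ 2 * (ℓ : ℝ) ^ 4 := by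
      nlinarith [mul_le_mul_of_nonneg_left h1 hδ2]
    have h2' : 2 * (N : ℝ) * (((plaquettesTouching (boxEdges x₀ ℓ)).card : ℝ) - (plaqsIn (boxEdges x₀ ℓ)).card) ≤
        192 * N * (ℓ : ℝ) ^ 3 := by
      nlinarith [mul_le_mul_of_nonneg_left h2 hN]
    have hsum := add_le_add h1' h2'
    nlinarith [mul_le_mul_of_nonneg_left hsum hβ]
  -- union bound over the sub-boxes
  have hXcard : (X.card : ℝ) ≤ (2 * b : ℝ) ^ 4 := by
    have h : X.card ≤ (2 * b) ^ 4 :=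
      (Finset.card_filter_le (cellSites w c) (fun x₀ => boxSites x₀ ℓ ⊆ cellSites w c)).trans (card_cellSites_le hw c)
    exact_mod_cast h
  calc (ymSpecification ρ β (cellEdges w c) ζ) (diluteTyp ρ w ℓ T c)ᶜ
      ≤ (ymSpecification ρ β (cellEdges w c) ζ)
          (⋃ x₀ ∈ X, {σ : LGConfig 4 G | T ≤ actionIn ρ (boxEdges x₀ ℓ) σ}) :=
        measure_mono (compl_diluteTyp_subset ρ hℓ T)
    _ ≤ ∑ x₀ ∈ X, (ymSpecification ρ β (cellEdges w c) ζ) {σ : LGConfig 4 G | T ≤ actionIn ρ (boxEdges x₀ ℓ) σ} :=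
        measure_biUnion_finset_le X _
    _ ≤ ∑ _x₀ ∈ X, ENNReal.ofReal B := Finset.sum_le_sum hbox
    _ = X.card * ENNReal.ofReal B := by rw [Finset.sum_const, nsmul_eq_mul]
    _ ≤ ENNReal.ofReal ((2 * b : ℝ) ^ 4) * ENNReal.ofReal B := by
        gcongr
        rw [← ENNReal.ofReal_natCast]
        exact ENNReal.ofReal_le_ofReal hXcard
    _ = ENNReal.ofReal ((2 * b : ℝ) ^ 4 * B) := by rw [ENNReal.ofReal_mul (by positivity)]

/-- **Clause (ii_T) of `TypShellCond` for the dilute class** — hereditary joint rarity under the kernels `γ_{F'}`,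
for every exterior, with `δ_cell = (2b)⁴ exp(β(48δ²ℓ⁴ + 192Nℓ³) − βT)/m^{4ℓ⁴}` (hereditary upgrade). -/
theorem collarJointRarity_diluteTyp (hρ : Continuous ρ) (hU : ∀ g, ρ g ∈ Matrix.unitaryGroup (Fin N) ℂ) {β : ℝ}
    (hβ : 0 ≤ β) {b : ℕ} {w : Fin 4 → ℤ → ℤ}
    (hw : ∀ i j, w i j + ((b : ℕ) : ℤ) ≤ w i (j + 1) ∧ w i (j + 1) ≤ w i j + 2 * ((b : ℕ) : ℤ))
    {ℓ : ℕ} (hℓ : 1 ≤ ℓ) {δ m : ℝ} (hm : 0 < m)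
    (hball : ENNReal.ofReal m ≤ haarProbability G {g : G | ‖ρ g - 1‖ ≤ δ}) (T : ℝ) :
    ∀ F F' : Finset (Fin 4 → ℤ), F ⊆ F' → F.Nonempty → ∀ ζ : LGConfig 4 G,
      (∀ c' : Fin 4 → ℤ, c' ∉ F' → (∃ c ∈ F', ∀ i, |c' i - c i| ≤ 1) → ζ ∈ diluteTyp ρ w ℓ T c') →
        (ymSpecification ρ β (regionEdges w F') ζ) {σ : LGConfig 4 G | ∀ c ∈ F, σ ∉ diluteTyp ρ w ℓ T c} ≤
          ENNReal.ofReal (((2 * b : ℝ) ^ 4 *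
            (Real.exp (β * (48 * δ ^ 2 * (ℓ : ℝ) ^ 4 + 192 * N * (ℓ : ℝ) ^ 3) - β * T) / m ^ (4 * ℓ ^ 4))) ^ F.card) :=
  collarJointRarity_of_supCellRarity ρ hρ β hw (measurableSet_diluteTyp ρ hρ w ℓ T) (dependsOn_diluteTyp ρ w ℓ T)
    (by positivity) (supCellRarity_diluteTyp ρ hρ hU hβ hw hℓ hm hball T)

/-- **Clause (iii_T) of `TypShellCond` for the dilute class** — the torus anchor on every odd torus `2S+1 ≥ 4b`
(`b ≥ 1`), same `δ_cell` (torus upgrade). -/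
theorem torusJointRarity_diluteTyp (hρ : Continuous ρ) (hU : ∀ g, ρ g ∈ Matrix.unitaryGroup (Fin N) ℂ) {β : ℝ}
    (hβ : 0 ≤ β) {b : ℕ} (hb : 1 ≤ b) {w : Fin 4 → ℤ → ℤ}
    (hw : ∀ i j, w i j + ((b : ℕ) : ℤ) ≤ w i (j + 1) ∧ w i (j + 1) ≤ w i j + 2 * ((b : ℕ) : ℤ))
    {ℓ : ℕ} (hℓ : 1 ≤ ℓ) {δ m : ℝ} (hm : 0 < m)
    (hball : ENNReal.ofReal m ≤ haarProbability G {g : G | ‖ρ g - 1‖ ≤ δ}) (T : ℝ) :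
    ∀ S : ℕ, 4 * b ≤ 2 * S + 1 → ∀ F : Finset (Fin 4 → ℤ), F.Nonempty →
      (∀ c ∈ F, ∀ i, -(S : ℤ) ≤ w i (c i) ∧ w i (c i + 1) ≤ (S : ℤ) + 1) →
        (wilsonMeasure (d := 4) (L := 2 * S + 1) ρ β)
            {V : GaugeConfig 4 (2 * S + 1) G | ∀ c ∈ F, torusLift (2 * S + 1) V ∉ diluteTyp ρ w ℓ T c} ≤
          ENNReal.ofReal (((2 * b : ℝ) ^ 4 *
            (Real.exp (β * (48 * δ ^ 2 * (ℓ : ℝ) ^ 4 + 192 * N * (ℓ : ℝ) ^ 3) - β * T) / m ^ (4 * ℓ ^ 4))) ^ F.card) :=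
  torusJointRarity_of_supCellRarity ρ hρ β hb hw (measurableSet_diluteTyp ρ hρ w ℓ T) (dependsOn_diluteTyp ρ w ℓ T)
    (by positivity) (supCellRarity_diluteTyp ρ hρ hU hβ hw hℓ hm hball T)

end Dilute

end Summit.QuantumFields.YangMills.Theorems.IRKernelLargeField

end
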